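import Summits.KontsevichZagierPeriods.KontsevichZagierPeriods.Statement
import Literature.NumberTheory.Transcendental.KZKernelConjectureForms
import Mathlib

/-!
# ON-PATH LEMMA (F4) for the rung `NeronTorsionShiftedSectors` — line `shifted_eta_sector`
# (crux `TorsionSectorComplete`, stmt-KontsevichZagierPeriods-14212; route `TorsionLogs`, route-KontsevichZagierPeriods-TorsionLogs)

`neronTorsionShiftedSectors_of_kontsevichZagierPeriods : KontsevichZagierPeriods → NeronTorsionShiftedSectors`
(sorry-free; standard axioms): Conjecture 1 in kernel form (`Literature…kzKernelConjecture_iff_isRational`: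
every rational formal combination evaluating to `0` is a relation) gives every TIED element — the value hypothesis
`M·[rI] + k·[rP] = m·[rL]` says exactly that `M•rI + k•rP − m•rL` evaluates to `0`.  Five lines.  This is the
`S ⇒ Rung` direction the forward tribunal reads (`on_path=true`, closed by `intro h; aesop` through the `@[simp]`
tag); the other end of the rung is pinned to the PROVED floor by `Lines/NeronTorsionShiftedSectors_special.lean`
(`NeronTorsionShiftedSector 0` from the seed `stub_assembly`), which is what discharges the [nec]-trap: the rung is
a consequence of S that is NOT a consequence of the floor (kernel probe `floor → rung` open, `real_step=true`) and
does NOT give S back (probe `rung → S` open; BC2).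
Self-contained: verbatim copies of the two `def`s of `Lines/shifted_eta_sector.lean` in the namespace
`…ShiftedEtaSector.OnPath` (the skeleton module carries the same theorem about the registered decl
`…ShiftedEtaSector.NeronTorsionShiftedSectors`).
-/

-- `Summit.KontsevichZagierPeriods.KontsevichZagierPeriods.…` is the tree's mandated layout (single-conjunct summit).
set_option linter.dupNamespace false

namespace Summit.KontsevichZagierPeriods.KontsevichZagierPeriods.Cruxes.TorsionSectorComplete.ShiftedEtaSector.OnPath

open Literature.NumberTheory.Transcendental

/-- The tied Néron–torsion sector with the η-carrier shifted to the rational pole `x′ = ξ < e₁`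
(`NeronTorsionSector` verbatim except `0 < e₁ ↦ (ξ:ℝ) < e₁` and the carrier `h₀ ↦ h_ξ`). [cite: KontsevichZagier2001, §1.2] -/
def NeronTorsionShiftedSector (ξ : ℚ) : Prop :=
  ∀ (g₂ g₃ e₁ xP yP α : ℝ) (N a : ℕ) (M k m : ℤ) (f : ℝ → ℝ), (∀ x, f x = 4 * x ^ 3 - g₂ * x - g₃) → g₂ ^ 3 - 27 * g₃ ^ 2 ≠ 0 → f e₁ = 0 → (ξ : ℝ) < e₁ → (∀ x, e₁ < x → 0 < f x) → e₁ < xP → yP ^ 2 = f xP → 3 ≤ N → 0 < a → 2 * a < N → 4 * (N : ℤ) ^ 2 * k = M * ((N : ℤ) - 2 * (a : ℤ)) ^ 2 → (∀ hns : (⟨0, 0, 0, -g₂ / 4, -g₃ / 4⟩ : WeierstrassCurve ℝ).toAffine.Nonsingular xP (yP / 2), addOrderOf (WeierstrassCurve.Affine.Point.some xP (yP / 2) hns) = N) → (N : ℝ) * (∫ x in Set.Ioi xP, (Real.sqrt (f x))⁻¹) = a * (2 * ∫ x in Set.Ioi e₁, (Real.sqrt (f x))⁻¹) → 1 < α → ∀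 (rI rP : Literature.NumberTheory.Transcendental.KZ.IntegralRep 2) (rL : Literature.NumberTheory.Transcendental.KZ.IntegralRep 1), rI.domain = {z | e₁ < z 1 ∧ z 1 < z 0 ∧ z 0 < xP} → Set.EqOn rI.integrand (fun z => z 1 / (Real.sqrt (f (z 1)) * Real.sqrt (f (z 0)))) rI.domain → rP.domain = {z | e₁ < z 0 ∧ e₁ < z 1} → Set.EqOn rP.integrand (fun z => (Real.sqrt (f (z 0)))⁻¹ * ((g₂ * z 1 + 2 * g₃ + (ξ : ℝ) * (g₂ - 4 * (z 1) ^ 2 - 4 * (ξ : ℝ) * z 1)) / (2 * (z 1 - (ξ : ℝ)) ^ 2 * Real.sqrt (f (z 1))))) rP.domain → rL.domain = {t | 1 < t 0 ∧ t 0 < α} → Set.EqOn rL.integrand (fun t => (t 0)⁻¹) rL.domain → (M : ℝ) * rI.value + k * rP.value = m * rL.value → M • Literature.NumberTheory.Transcendental.KZ.of rI + k • Literature.NumberTheory.Transcendental.KZ.of rP - m • Literature.NumberTheory.Transcendental.KZ.of rL ∈ Literature.NumberTheory.Transcendental.KZ.relations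

/-- **THE RUNG** (`rung_decl`): the shifted Néron–torsion sector for every rational pole `ξ`. -/
def NeronTorsionShiftedSectors : Prop :=
  ∀ ξ : ℚ, NeronTorsionShiftedSector ξ


/-- **F4 ON-PATH LEMMA — the summit implies the rung.** [cite: KontsevichZagier2001, §1.2] -/
@[simp] theorem neronTorsionShiftedSectors_of_kontsevichZagierPeriods (h : _root_.KontsevichZagierPeriods) :
    NeronTorsionShiftedSectors := by
  have hK : KZKernelConjecture := kzKernelConjecture_iff_isRational.mpr h
  intro ξ g₂ g₃ e₁ xP yP α N a M k m f _ _ _ _ _ _ _ _ _ _ _ _ _ _ rI rP rL _ _ _ _ _ _ hval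
  apply hK
  rw [map_sub, map_add, map_zsmul, map_zsmul, map_zsmul, KZ.eval_of, KZ.eval_of, KZ.eval_of, zsmul_eq_mul,
    zsmul_eq_mul, zsmul_eq_mul]
  linarith [hval]

/-- Member-wise form. -/
theorem neronTorsionShiftedSector_of_kontsevichZagierPeriods (h : _root_.KontsevichZagierPeriods) (ξ : ℚ) :
    NeronTorsionShiftedSector ξ :=
  neronTorsionShiftedSectors_of_kontsevichZagierPeriods h ξ

end Summit.KontsevichZagierPeriods.KontsevichZagierPeriods.Cruxes.TorsionSectorComplete.ShiftedEtaSector.OnPath
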